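import Summits.CriticalPhenomena.PercolationContinuityZ3.Theorems.PercNearOneGluingNoHeavyLowerTailSahiSliceMinimumBernstein

/-!
# `NoHeavyLowerTail` (crux stmt-CriticalPhenomena-4575), Sahi programme P2 (gen 16): the slice minimum principle at EVERY
# live coin for triples with TWO EQUAL MEMBERS `(U, U, V)`

Support file (`--supports stmt-CriticalPhenomena-4575`; companion of `…SahiSliceMinimum` / `…SahiSliceMinimumBernstein`).
The second proved family of the SLICE MINIMUM PRINCIPLE (`SahiSliceMinimum.SliceMinimumPrinciple 3`, which implies Kahn's
Conjecture 5): after the diagonal triples `(U,U,U)` (`sliceMinimum_diag`), the triples with two equal members.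

THE ARGUMENT.  For indicators, `E_3(1_U, 1_U, 1_V) = (1 − μ(U))·(2μ(U∩V) − μ(U)μ(V))` (`sahiE_three_pair_eq`).  Along a coin `e`
with bias `s` every moment is affine, `M_s(h) = s·X₁(h) + (1−s)·X₀(h)`; so the fibre is `g(s) = a(s)·q(s)` with
`a(s) = 1 − M_s(1_U) ≥ 0` AFFINE and `q(s) = 2M_s(1_U 1_V) − M_s(1_U)M_s(1_V)` a CONCAVE quadratic
(`q(s) − [(1−s)q(0) + s q(1)] = s(1−s)·(X₁−X₀)(1_U)·(X₁−X₀)(1_V) ≥ 0` for increasing `U, V`) with nonnegative endpoint values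
(Harris on the two sections, `secEx_harris`).  Hence `g(s) ≥ a(s)·[(1−s)q₀ + s q₁] = (1−s)²g₀ + s²g₁ + s(1−s)(a₀q₁ + a₁q₀)
≥ min(g₀, g₁)`, because `a₀q₁ + a₁q₀ ≥ 2√(a₀q₁·a₁q₀) = 2√(g₀g₁) ≥ 2 min(g₀,g₁)` (`pair_fibre_ge_min`).  So
**`min(E_3 of the two e-sections) ≤ E_3`** for `(U,U,V)` at every coin and every product measure (`sliceMinimum_pair`, and the
placements `(U,V,U)`, `(V,U,U)` by symmetry of `E_3`).  Everything here is proved; axioms standard. [this work]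
-/

noncomputable section

open scoped Classical

namespace Summit.CriticalPhenomena.PercolationContinuityZ3.Theorems

open Finset Function
open Literature.Combinatorics.Sahi2008
open Literature.Probability.Percolation.DecisionTree (ind ind_of_mem ind_of_not_mem ind_nonneg)

namespace SahiSliceMinimum

variable {ι : Type} [Fintype ι]

/-! ### Harris on a section, and the algebraic core -/

/-- A section moment is an expectation under the product measure with the coin frozen. [folklore] -/
theorem secEx_eq_ex_update (p : ι → unitInterval) (e : ι) (h : Set ι → ℝ) (b : Bool) :
    secEx p e h b = ex (bernoulliWeight (update p e (if b then 1 else 0))) h := by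
  cases b
  · simp only [Bool.false_eq_true, if_false, ex_update_eq, Set.Icc.coe_zero]; ring
  · simp only [if_true, ex_update_eq, Set.Icc.coe_one]; ring

/-- **Harris on a section**: `X_b(1_U)·X_b(1_V) ≤ X_b(1_U·1_V)` for increasing `U, V` (the order-2 slice principle of
`…SahiSliceMinimum` gives `MasterFamilyNonneg 2`, i.e. Harris for every product measure, applied to the frozen measure).
[folklore] -/
theorem secEx_harris (p : ι → unitInterval) (e : ι) {U V : Set (Set ι)} (hU : IsUpperSet U) (hV : IsUpperSet V) (b : Bool) :
    secEx p e (ind U) b * secEx p e (ind V) b ≤ secEx p e (ind U * ind V) b := by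
  simp only [secEx_eq_ex_update]
  set q : ι → unitInterval := update p e (if b then 1 else 0)
  have h2 := masterFamilyNonneg_of_sliceMinimumPrinciple sliceMinimumPrinciple_two ι q ![U, V]
    (by intro j; fin_cases j <;> assumption)
  have hf : (fun j => ind ((![U, V] : Fin 2 → Set (Set ι)) j)) = ![ind U, ind V] := by
    funext j; fin_cases j <;> rfl
  rw [hf, sahiE_two] at h2
  linarith

/-- Section moments of a product of two indicators are nonnegative. [folklore] -/
theorem secEx_ind_mul_nonneg (p : ι → unitInterval) (e : ι) (U V : Set (Set ι)) (b : Bool) :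
    0 ≤ secEx p e (ind U * ind V) b := by
  unfold secEx
  exact sum_nonneg fun ω _ =>
    mul_nonneg (offWeight_nonneg p e ω) (by rw [Pi.mul_apply]; exact mul_nonneg (ind_nonneg U _) (ind_nonneg V _))

/-- **The algebraic core.**  With `a_b = 1 − u_b ≥ 0`, `q_b = 2w_b − u_bv_b ≥ 0`, `u₀ ≤ u₁`, `v₀ ≤ v₁`, the fibre
`g(s) = (1 − u(s))(2w(s) − u(s)v(s))` of affine `u, v, w` dominates `min(g(0), g(1))` on `[0,1]`. [this work] -/
theorem pair_fibre_ge_min {s u₀ u₁ v₀ v₁ w₀ w₁ : ℝ} (hs0 : 0 ≤ s) (hs1 : s ≤ 1) (hu0 : u₀ ≤ 1) (hu1 : u₁ ≤ 1)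
    (huu : u₀ ≤ u₁) (hvv : v₀ ≤ v₁) (hq0 : u₀ * v₀ ≤ 2 * w₀) (hq1 : u₁ * v₁ ≤ 2 * w₁) :
    min ((1 - u₀) * (2 * w₀ - u₀ * v₀)) ((1 - u₁) * (2 * w₁ - u₁ * v₁)) ≤
      (1 - (s * u₁ + (1 - s) * u₀)) *
        (2 * (s * w₁ + (1 - s) * w₀) - (s * u₁ + (1 - s) * u₀) * (s * v₁ + (1 - s) * v₀)) := by
  set a₀ := 1 - u₀ with ha₀
  set a₁ := 1 - u₁ with ha₁
  set q₀ := 2 * w₀ - u₀ * v₀ with hq₀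
  set q₁ := 2 * w₁ - u₁ * v₁ with hq₁
  set m := min (a₀ * q₀) (a₁ * q₁) with hm
  have ha0 : 0 ≤ a₀ := by rw [ha₀]; linarith
  have ha1 : 0 ≤ a₁ := by rw [ha₁]; linarith
  have hq0' : 0 ≤ q₀ := by rw [hq₀]; linarith
  have hq1' : 0 ≤ q₁ := by rw [hq₁]; linarith
  have hm0 : m ≤ a₀ * q₀ := min_le_left _ _
  have hm1 : m ≤ a₁ * q₁ := min_le_right _ _
  have hmnn : 0 ≤ m := le_min (mul_nonneg ha0 hq0') (mul_nonneg ha1 hq1')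
  -- the cross terms dominate `2m`: `(a₀q₁ + a₁q₀)² ≥ 4·(a₀q₀)(a₁q₁) ≥ 4m²`
  have hX : 0 ≤ a₀ * q₁ := mul_nonneg ha0 hq1'
  have hY : 0 ≤ a₁ * q₀ := mul_nonneg ha1 hq0'
  have hprod : m * m ≤ (a₀ * q₁) * (a₁ * q₀) := by
    calc m * m ≤ (a₀ * q₀) * (a₁ * q₁) := mul_le_mul hm0 hm1 hmnn (mul_nonneg ha0 hq0')
      _ = (a₀ * q₁) * (a₁ * q₀) := by ring
  have hcross : 2 * m ≤ a₀ * q₁ + a₁ * q₀ := by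
    nlinarith [sq_nonneg (a₀ * q₁ - a₁ * q₀), sq_nonneg (a₀ * q₁ + a₁ * q₀ - 2 * m)]
  -- the fibre: `g(s) = a(s)·q(s)`, `a(s) ≥ 0`, `q(s) ≥ ℓ(s) = (1−s)q₀ + s q₁` (concavity), then expand `a(s)ℓ(s)`
  have has : 0 ≤ (1 - s) * a₀ + s * a₁ := by nlinarith
  have hconc : (1 - s) * q₀ + s * q₁ ≤
      2 * (s * w₁ + (1 - s) * w₀) - (s * u₁ + (1 - s) * u₀) * (s * v₁ + (1 - s) * v₀) := by
    have : 2 * (s * w₁ + (1 - s) * w₀) - (s * u₁ + (1 - s) * u₀) * (s * v₁ + (1 - s) * v₀) -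
        ((1 - s) * q₀ + s * q₁) = s * (1 - s) * ((u₁ - u₀) * (v₁ - v₀)) := by
      rw [hq₀, hq₁]; ring
    nlinarith [mul_nonneg (mul_nonneg hs0 (sub_nonneg.2 hs1)) (mul_nonneg (sub_nonneg.2 huu) (sub_nonneg.2 hvv))]
  have hfac : (1 - (s * u₁ + (1 - s) * u₀)) = (1 - s) * a₀ + s * a₁ := by rw [ha₀, ha₁]; ring
  rw [hfac]
  calc m = (1 - s) ^ 2 * m + s ^ 2 * m + s * (1 - s) * (2 * m) := by ring
    _ ≤ (1 - s) ^ 2 * (a₀ * q₀) + s ^ 2 * (a₁ * q₁) + s * (1 - s) * (a₀ * q₁ + a₁ * q₀) := by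
        nlinarith [mul_nonneg (pow_nonneg (sub_nonneg.2 hs1) 2) (sub_nonneg.2 hm0),
          mul_nonneg (pow_nonneg hs0 2) (sub_nonneg.2 hm1),
          mul_nonneg (mul_nonneg hs0 (sub_nonneg.2 hs1)) (sub_nonneg.2 hcross)]
    _ = ((1 - s) * a₀ + s * a₁) * ((1 - s) * q₀ + s * q₁) := by ring
    _ ≤ ((1 - s) * a₀ + s * a₁) *
          (2 * (s * w₁ + (1 - s) * w₀) - (s * u₁ + (1 - s) * u₀) * (s * v₁ + (1 - s) * v₀)) :=
        mul_le_mul_of_nonneg_left hconc has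

/-! ### The fibre of `(U, U, V)` and the slice inequality at every coin -/

omit [Fintype ι] in
/-- `1_U · 1_U · 1_V = 1_U · 1_V`. [folklore] -/
theorem ind_mul_self_mul (U V : Set (Set ι)) : ind U * ind U * ind V = ind U * ind V := by
  rw [ind_mul_self]

/-- **The fibre of `(U,U,V)` along `e`** in section moments: with `u = M_s(1_U)`, `v = M_s(1_V)`, `w = M_s(1_U1_V)`,
`E_3(μ_{p[e↦s]}; 1_U,1_U,1_V) = (1 − u)(2w − uv)`. [this work] -/
theorem sahiE_three_pair_update (p : ι → unitInterval) (e : ι) (s : unitInterval) (U V : Set (Set ι)) :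
    sahiE (bernoulliWeight (update p e s)) 3 ![ind U, ind U, ind V] =
      (1 - ((s : ℝ) * secEx p e (ind U) true + (1 - (s : ℝ)) * secEx p e (ind U) false)) *
        (2 * ((s : ℝ) * secEx p e (ind U * ind V) true + (1 - (s : ℝ)) * secEx p e (ind U * ind V) false) -
          ((s : ℝ) * secEx p e (ind U) true + (1 - (s : ℝ)) * secEx p e (ind U) false) *
            ((s : ℝ) * secEx p e (ind V) true + (1 - (s : ℝ)) * secEx p e (ind V) false)) := by
  rw [sahiE_three, ind_mul_self_mul, ind_mul_self]
  simp only [ex_update_eq]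
  ring

/-- **THE SLICE MINIMUM PRINCIPLE AT EVERY COIN FOR `(U, U, V)`** (min form): for increasing `U, V`, every coin `e` and
every `s ∈ [0,1]`, `min(E_3(μ_{p[e↦0]}), E_3(μ_{p[e↦1]})) ≤ E_3(μ_{p[e↦s]})` for the triple `(1_U, 1_U, 1_V)`. [this work] -/
theorem pair_slice_min_le (p : ι → unitInterval) (e : ι) (s : unitInterval) {U V : Set (Set ι)} (hU : IsUpperSet U)
    (hV : IsUpperSet V) :
    min (sahiE (bernoulliWeight (update p e 0)) 3 ![ind U, ind U, ind V])
        (sahiE (bernoulliWeight (update p e 1)) 3 ![ind U, ind U, ind V]) ≤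
      sahiE (bernoulliWeight (update p e s)) 3 ![ind U, ind U, ind V] := by
  have h0 := sahiE_three_pair_update p e 0 U V
  have h1 := sahiE_three_pair_update p e 1 U V
  rw [Set.Icc.coe_zero] at h0
  rw [Set.Icc.coe_one] at h1
  have e0 : sahiE (bernoulliWeight (update p e 0)) 3 ![ind U, ind U, ind V] =
      (1 - secEx p e (ind U) false) *
        (2 * secEx p e (ind U * ind V) false - secEx p e (ind U) false * secEx p e (ind V) false) := by
    rw [h0]; ring
  have e1 : sahiE (bernoulliWeight (update p e 1)) 3 ![ind U, ind U, ind V] =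
      (1 - secEx p e (ind U) true) *
        (2 * secEx p e (ind U * ind V) true - secEx p e (ind U) true * secEx p e (ind V) true) := by
    rw [h1]; ring
  rw [e0, e1, sahiE_three_pair_update]
  have hw0 := secEx_harris p e hU hV false
  have hw1 := secEx_harris p e hU hV true
  have hn0 := secEx_ind_mul_nonneg p e U V false
  have hn1 := secEx_ind_mul_nonneg p e U V true
  exact pair_fibre_ge_min s.2.1 s.2.2 (secEx_ind_mem p e U false).2 (secEx_ind_mem p e U true).2
    (secEx_ind_mono p e hU) (secEx_ind_mono p e hV) (by linarith) (by linarith)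

/-- **The slice minimum principle holds at EVERY live coin for `(U, U, V)`** (the form used by `SliceMinimumPrinciple`:
some `b ∈ {0,1}` with `E_3(μ_{p[e↦b]}) ≤ E_3(μ_p)`). [this work] -/
theorem sliceMinimum_pair (p : ι → unitInterval) {U V : Set (Set ι)} (hU : IsUpperSet U) (hV : IsUpperSet V) (e : ι) :
    ∃ b : unitInterval, ((b : ℝ) = 0 ∨ (b : ℝ) = 1) ∧
      sahiE (bernoulliWeight (update p e b)) 3 ![ind U, ind U, ind V] ≤
        sahiE (bernoulliWeight p) 3 ![ind U, ind U, ind V] := by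
  have key := pair_slice_min_le p e (p e) hU hV
  rw [update_eq_self] at key
  rcases min_le_iff.1 key with h | h
  · exact ⟨0, Or.inl Set.Icc.coe_zero, h⟩
  · exact ⟨1, Or.inr Set.Icc.coe_one, h⟩

/-- `E_3` is symmetric in its last two arguments. [folklore] -/
theorem sahiE_three_swap23 (μ : Set ι → ℝ) (f g h : Set ι → ℝ) : sahiE μ 3 ![f, h, g] = sahiE μ 3 ![f, g, h] := by
  rw [sahiE_three, sahiE_three, mul_right_comm f h g, mul_comm h g]
  ring

/-- `E_3` is symmetric in its first two arguments. [folklore] -/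
theorem sahiE_three_swap12 (μ : Set ι → ℝ) (f g h : Set ι → ℝ) : sahiE μ 3 ![g, f, h] = sahiE μ 3 ![f, g, h] := by
  rw [sahiE_three, sahiE_three, mul_comm g f, mul_comm g h, mul_comm f h]
  ring

/-- The placement `(U, V, U)`. [this work] -/
theorem sliceMinimum_pair' (p : ι → unitInterval) {U V : Set (Set ι)} (hU : IsUpperSet U) (hV : IsUpperSet V) (e : ι) :
    ∃ b : unitInterval, ((b : ℝ) = 0 ∨ (b : ℝ) = 1) ∧
      sahiE (bernoulliWeight (update p e b)) 3 ![ind U, ind V, ind U] ≤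
        sahiE (bernoulliWeight p) 3 ![ind U, ind V, ind U] := by
  simp only [sahiE_three_swap23 _ (ind U) (ind U) (ind V)]
  exact sliceMinimum_pair p hU hV e

/-- The placement `(V, U, U)`. [this work] -/
theorem sliceMinimum_pair'' (p : ι → unitInterval) {U V : Set (Set ι)} (hU : IsUpperSet U) (hV : IsUpperSet V) (e : ι) :
    ∃ b : unitInterval, ((b : ℝ) = 0 ∨ (b : ℝ) = 1) ∧
      sahiE (bernoulliWeight (update p e b)) 3 ![ind V, ind U, ind U] ≤
        sahiE (bernoulliWeight p) 3 ![ind V, ind U, ind U] := by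
  have hs : ∀ μ : Set ι → ℝ, sahiE μ 3 ![ind V, ind U, ind U] = sahiE μ 3 ![ind U, ind U, ind V] := by
    intro μ; rw [sahiE_three_swap12 μ (ind U) (ind V) (ind U), sahiE_three_swap23 μ (ind U) (ind U) (ind V)]
  simp only [hs]
  exact sliceMinimum_pair p hU hV e

end SahiSliceMinimum

end Summit.CriticalPhenomena.PercolationContinuityZ3.Theorems
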